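import Mathlib
import Summits.Ventures.PercRepro2.Defs
import Summits.Ventures.PercRepro2.Graph
import Summits.Ventures.PercRepro2.Induced
import Summits.Ventures.PercRepro2.GateDefs

/-!
# (LIN-D A,B): the finest hull-frame linearisation of the WHOLE gate family (blind cell PercRepro2,
mine-c g7, MINE-C.md §14.3, proofs/MINEC-LIND.md §3)

For the gate `Gate.gateEvent s T A B = R_T ∖ {S hits A ∧ K hits B}` (one one-way gadget `A → z → B`),
the **backward cluster** of `T` in the gadget digraph is `Z = K` when the hull `K` avoids `B`, and
`Z = K ∪ ⋃_{v ∈ A} C_{H ∖ K}(v)` when `K` hits `B` (every vertex reaching `A` reaches `T` through the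
gadget); the gate event is `{s ∉ Z}`. Given `Z` the configuration on `H ∖ Z` is product, so
`x_Z := P_{H ∖ Z}(s ↔ a)` (`delClusterProb`) is the conditional marker probability.

**(LIN-D A,B)**: `E[(x_Z − m_X)(y_Z − m_Y); s ∉ Z] ≥ 0` with the `R_T`-centring `m = E[· | R_T]`, cleared
by `P(R_T)²`. It implies `Gate.GateRow s T a b A B` (inner Harris covariances in `H ∖ Z` are ≥ 0), reduces
to the linearised Lemma A′ when `A` is everything and to the linearised Lemma A when `B ⊇ T`, and
specialises to `LinD.LinDRow` for `A = {u}`, `B = {w}`.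

Census (mine-c g7, exact): `n = 6` ALL graphs × 3 palette vectors × every `(s, t, a, b)` × all gadgets
with `|A|, |B| ≤ 2` (overlaps allowed) 0 / 544,320 (ties 111,738); `n = 6` every 4th graph, `|A|,|B| ≤ 3`
0 / 45,360; `n = 7` every 29th graph 0 / 453,600; avoided sets `|T| = 2` and marker sets 0 / 614,160;
(1+1)-ES 1,680 gadget climbs: 0 exact negatives, 1,671 exact ties.
-/

namespace Summit.Ventures.PercRepro2

namespace LinDGen

variable {V : Type*} {E : Type*}

section Sets

variable (ends : E → Sym2 V) (T A B : Finset V)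

/-- The hull `K = ⋃_{t ∈ T} C(t)` of the avoided set. -/
def hull (ω : Config E) : Set V := {v | ∃ t ∈ T, Conn ends ω t v}

/-- `{K hits B}` as a predicate on the configuration. -/
def hullHits (ω : Config E) : Prop := ∃ w ∈ B, w ∈ hull ends T ω

open Classical in
/-- The **backward cluster** of `T` in the gadget digraph `H + (A → z → B)`: the hull, with the clusters
of the vertices of `A` in `H ∖ K` attached when the hull hits `B`. -/
noncomputable def backCluster (ω : Config E) : Set V :=
  hull ends T ω ∪
    (if hullHits ends T B ω then ⋃ v ∈ (A : Set V), cluster ends (delConfig ends (hull ends T ω) ω) v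
     else ∅)

/-- The hull is contained in the backward cluster. -/
lemma hull_subset_backCluster (ω : Config E) : hull ends T ω ⊆ backCluster ends T A B ω :=
  Set.subset_union_left

end Sets

section Row

variable [Fintype E] [DecidableEq E] [DecidableEq V] {R : Type*} [Field R] [LinearOrder R]

variable (p : E → R) (ends : E → Sym2 V) (s : V) (T : Finset V) (a : V) (A B : Finset V)

/-- `x_Z = P_{H ∖ Z}(a ∈ C(s))` for the backward cluster `Z = Z(ω)` of the gadget digraph. -/
noncomputable def xZ (ω : Config E) : R :=
  delClusterProb p ends s {W | a ∈ W} (backCluster ends T A B ω)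

end Row

section Statement

variable [Fintype E] [DecidableEq E] [DecidableEq V] {R : Type*} [Field R] [LinearOrder R]

variable (p : E → R) (ends : E → Sym2 V) (s : V) (T : Finset V) (a b : V) (A B : Finset V)

/-- **(LIN-D A,B)**, cleared by `P(R_T)²`:
`E[ 1_{gate A B} · (x_Z P(R_T) − P(a ∈ S; R_T)) · (y_Z P(R_T) − P(b ∈ S; R_T)) ] ≥ 0`. -/
def LinDRow : Prop :=
  0 ≤ expect p (fun ω =>
        (Gate.gateEvent ends s T A B).indicator (fun _ => (1 : R)) ω *
          (xZ p ends s T a A B ω * prob p (avoidAll ends s T) -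
            prob p (connAll ends s {a} ∩ avoidAll ends s T)) *
          (xZ p ends s T b A B ω * prob p (avoidAll ends s T) -
            prob p (connAll ends s {b} ∩ avoidAll ends s T)))

end Statement

section Closure

variable (R : Type*) [Field R] [LinearOrder R] [IsStrictOrderedRing R]

/-- **(LIN-D A,B) over all finite graphs**, admissible weights, roots `s ∉ T`, markers `a, b` and gadget
sets `A, B ⊆ V ∖ (T ∪ {s})`: the linearised statement of record of row 2′CON-W (implies
`Gate.GateRow_all`). -/
def LinDRow_all : Prop :=
  ∀ (V E : Type) [Fintype V] [DecidableEq V] [Fintype E] [DecidableEq E]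
    (ends : E → Sym2 V) (p : E → R), IsProbVec p →
    ∀ (s : V) (T : Finset V) (a b : V) (A B : Finset V), s ∉ T →
      (∀ u ∈ A, u ∉ T ∧ u ≠ s) → (∀ w ∈ B, w ∉ T ∧ w ≠ s) → LinDRow p ends s T a b A B

end Closure

end LinDGen

end Summit.Ventures.PercRepro2
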